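import Mathlib
import HarnessLib

/-!
# Markman 2025 — the PERIOD DOMAIN `Ω_P` of abelian varieties of Weil type ([M] §4, Lemmas 4.0.1–4.0.3), AS PRINTED:
# the dimension count «orbit = 2n² = dim Gr(n, W_{1,ℂ})» and the rotation circle `I_θ = cos(θ)·id + sin(θ)·I`,
# kernel-checked

E. Markman: [M] *Cycles on abelian 2n-folds of Weil type from secant sheaves on abelian n-folds*,
arXiv:2502.03415 **v2** (2025-06-08), bib `Markman2025SecantWeil` — UNREFEREED PREPRINT. Pages/lines = PyMuPDF lines
of the public v2 PDF (sha256/16 `8155aa33870069b8`), read at seat lit-w-markman g14 (pub-hsemireg LIT-W,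
2026-08-23; sheet `LOCATOR-SHEET-MARKMAN.md` §44), BY EYE on 160-dpi renders — pre-filing statement read ×2 ACROSS SEATS
(lit-3 g40: CONCUR, word for word on the five windows; its pin P1 = the printed subscript `SO₊` and script `𝒮_I`, adopted)
(`HOME/lit/Markman-renders-litw-markman-g14/r_mar25_v2_p25_L401.png`, `…p26_L401_end.png`, `…p26_L402.png`,
`…p26_SI.png`, `…p27_L403.png`). Setting ([M] §3–§4): `V_ℚ` of dimension `4n` is a `2n`-dimensional `K`-vector space,
`K = ℚ(√−d)`; `W₁, W₂ ⊂ V_K` the two maximal isotropic eigenspaces (p. 14 L24), each `2n`-dimensional, with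
`W_i^{1,0} := W_{i,ℂ} ∩ V^{1,0}` both `n`-dimensional (p. 14 L62–65); `Ω_P ⊂ SO₊(V_ℝ)_f` «the subset of elements `I`,
such that `I` is a complex structure on `V_ℝ`, the eigenspaces of `f ∘ I` are both `2n`-dimensional, and the bilinear
form `g_I` in Corollary 3.2.3 is positive definite» ((4.0.1), p. 25 L37–41); `ι : Ω_P → Gr(n, W_{1,ℂ})`,
`ι(I) := V_I^{1,0} ∩ W_{1,ℂ}` (p. 25 L42–45).

## What is printed (verbatim, v2)
* LEMMA 4.0.1 (p. 25 L46–47): «The map `ι` is an embedding of `Ω_P` as a non-empty subset, open in the classical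
  topology, of the Grassmannian `Gr(n, W_{1,ℂ})`.» From its proof (p. 26 L4–12, L28–31): «Given an `n`-dimensional
  subspace `U` of `W_{1,ℂ}`, set `V_U^{1,0} := U ⊕ [U^⊥ ∩ W_{2,ℂ}]`. Then `V_U^{1,0}` is an isotropic `2n`-dimensional
  subspace of `V_ℂ`, invariant under `f`. … Furthermore, the `−√d`-eigenspace of `I ∘ f` is `U ⊕ Ū` and is
  `2n`-dimensional. Hence, `ν(I) = 2n`.»
* LEMMA 4.0.2 (p. 26 L39): «The connected components of `Ω_P` are `SO₊(V_ℝ)_f`-adjoint orbits.» Proof, second half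
  (p. 26 L48–69): «It remains to prove that the dimensions of the adjoint orbits of `I ∈ Ω_P` is equal to that of
  `Ω_P`. The dimension `dim_ℚ(SO₊(V_ℚ)_f)` is the dimension `(2n)² − 1` of `SU(V_ℚ, H)`, by Lemma 3.1.2. Hence,
  `dim_ℝ(SO₊(V_ℝ)_f) = 4n² − 1`. If `g ∈ SO₊(V_ℝ)_f` commutes with `I ∈ Ω_P`, then `g` leaves invariant each of the
  direct summands `W₁^{1,0}, W₁^{0,1}, W₂^{1,0}, W₂^{0,1}` in Lemma 2.2.6. Then `V_ℝ` decomposes as the `H`-orthogonal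
  direct sum of two `g`-invariant `H`-non-degenerate subspaces `[W₁^{1,0} ⊕ W₂^{0,1}] ∩ V_ℝ` and
  `[W₁^{0,1} ⊕ W₂^{1,0}] ∩ ℝ`. The determinants of the restrictions of `g` to the two direct summands are inverses
  of each other. We conclude that the real dimension of the commutator of `I` is `2 dim(U(n)) − 1 = 2n² − 1`. Thus
  the real dimension of the adjoint orbit is `2n²`. This is the dimension of each component of `Ω_P`, by Lemma
  4.0.1. □» (sic: «`∩ ℝ`» for `∩ V_ℝ`).
* p. 26 L74–75: «Consider the subgroup `𝒮_I := {cos(θ) id_{V_ℝ} + sin(θ) I : θ ∈ ℝ}` of `SO₊(V_ℝ)`.» (a script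
  `𝒮` in print; `S_I` below).
* LEMMA 4.0.3 (p. 27 L3–7): «(1) The plane `∧^{2n}W₁ ⊕ ∧^{2n}W₂` corresponds to a rational plane in `∧^{2n}V_ℚ`,
  which is spanned by Hodge classes, for every complex structure `I` in `Ω_P`. (2) The plane `P` is spanned by
  semi-Hodge classes, for every complex structure `I` in `Ω_P`.» Proof of (2) (p. 27 L8–22): «It suffices to show
  that `I_θ := cos(θ) id_{V_ℝ} + sin(θ) I` belongs to `SO₊(V_ℝ)_f`, for all `θ ∈ ℝ`, … We have seen that `I` is
  anti-self dual with respect to `(•, •)_V`. Hence, `I_θ† = cos(θ) id_V − sin(θ) I` and `I_θ† I_θ = id_V` and so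
  `I_θ` belongs to `SO(V_ℝ)`, for all `θ ∈ ℝ`, and hence to the connected component `SO₊(V_ℝ)` of `I`. Clearly,
  `I_θ` commutes with `f`, as `I` does. Now `I_θ` acts on `W_i^{1,0}` by scalar multiplication by
  `cos(θ) + √−1 sin(θ)` and on `W_i^{0,1}` by `cos(θ) − √−1 sin(θ)` and so the determinant of its restriction to
  `W_i` is `1`. Hence, `I_θ` belongs to `SO₊(V_ℝ)_f`. □»

## What this file proves (theorems only; NO definition, NO named fact, NO sorry)
§A — the COUNT of Lemma 4.0.2 / 4.0.1 as arithmetic in `ℕ` (truncated subtraction is harmless here, see the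
statements): `su_dim` (`(2n)² − 1 = 4n² − 1`), `stabiliser_dim` (`2·n² − 1`, with «`dim U(n) = n²`» as the printed
input), `orbit_dim` (`(4n² − 1) − (2n² − 1) = 2n²`), `grassmannian_real_dim` / `grassmannian_complex_dim` (`2 · n(2n − n) = 2n²`,
`n(2n − n) = n²` — the dimensions of `Gr(n, W_{1,ℂ})`, `dim_ℂ W_{1,ℂ} = 2n`), `orbit_dim_eq_component_dim` (the printed
conclusion «This is the dimension of each component of `Ω_P`»), `component_dim_three` (`n = 3`: real `18`, complex `9` =
the «9-dimensional moduli space of polarized abelian sixfolds of Weil type» of Theorem 1.4.1 (5), p. 7 L53–55), `isotropic_dim` / `nu_eq` (`n + (2n − n) = 2n`, `n + n = 2n`) and the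
honest linear-algebra form `finrank_sup_of_disjoint` (`dim(U ⊔ U′) = 2n` for disjoint `n`-dimensional `U, U′` —
«`U ⊕ Ū` … is `2n`-dimensional»).
§B — the ROTATION CIRCLE in any real algebra `A` (e.g. `End_ℝ(V_ℝ)`) through an element `I` with `I² = −1`:
`rot_mul_rot` (`I_θ I_φ = I_{θ+φ}` — «the subgroup `S_I`»), `rot_zero` (`I_0 = 1`), `dagger_rot` (for ANY `ℝ`-linear
`† : A → A` with `1† = 1`, `I† = −I`: `I_θ† = cos(θ)·1 − sin(θ)·I`), `rotDagger_mul_rot` / `rot_mul_rotDagger`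
(`I_θ† I_θ = 1 = I_θ I_θ†`), `comm_rot` («`I_θ` commutes with `f`, as `I` does»), and over `ℂ`: `rot_apply_of_eigen_I` /
`rot_apply_of_eigen_negI` (on an `i`- resp. `−i`-eigenvector `I_θ` is the scalar `cos θ ± √−1 sin θ`),
`rot_scalar_eq_exp` (`cos θ + √−1 sin θ = e^{√−1 θ}`), `det_rot_restrict` (`(cos θ + √−1 sin θ)^n (cos θ − √−1 sin θ)^n = 1`
— «the determinant of its restriction to `W_i` is `1`», `W_i = W_i^{1,0} ⊕ W_i^{0,1}`, `n + n`).
BY VALUE (printed inputs, not modelled): Lemma 3.1.2 (`SO₊(V_ℚ)_f` of finite index in `SU(V_ℚ, H)`), the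
anti-self-duality of `I`, positivity of `g_I`, openness, Lemma 2.2.6, `dim_ℝ U(n) = n²`.
Nothing in this file says that HC / HC_CM / HC_AV is proved or that any object is semiregular or hyperholomorphic.
-/

namespace Literature.AlgebraicGeometry.Markman2025.PeriodDomain

/-! ### §A. The dimension count of Lemma 4.0.2 (with Lemma 4.0.1) -/

/-- «The dimension `dim_ℚ(SO₊(V_ℚ)_f)` is the dimension `(2n)² − 1` of `SU(V_ℚ, H)`, by Lemma 3.1.2. Hence,
`dim_ℝ(SO₊(V_ℝ)_f) = 4n² − 1`.» [cite: Markman2025SecantWeil, Lemma 4.0.2 (proof), p. 26 L49–50] -/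
theorem su_dim (n : ℕ) : (2 * n) ^ 2 - 1 = 4 * n ^ 2 - 1 := by
  ring_nf

/-- «We conclude that the real dimension of the commutator of `I` is `2 dim(U(n)) − 1 = 2n² − 1`» — with the
printed input `dim_ℝ U(n) = n²` (two unitary blocks whose determinants are inverses of each other: one real
condition). [cite: Markman2025SecantWeil, Lemma 4.0.2 (proof), p. 26 L64–66] -/
theorem stabiliser_dim (n dimU : ℕ) (h : dimU = n ^ 2) : 2 * dimU - 1 = 2 * n ^ 2 - 1 := by
  subst h; rfl

/-- «Thus the real dimension of the adjoint orbit is `2n²`»: group minus stabiliser,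
`(4n² − 1) − (2n² − 1) = 2n²` (in `ℕ`; for `n = 0` both sides are `0`).
[cite: Markman2025SecantWeil, Lemma 4.0.2 (proof), p. 26 L66–68] -/
theorem orbit_dim (n : ℕ) : (4 * n ^ 2 - 1) - (2 * n ^ 2 - 1) = 2 * n ^ 2 := by
  generalize n ^ 2 = m
  omega

/-- The real dimension of the Grassmannian `Gr(n, W_{1,ℂ})`, `dim_ℂ W_{1,ℂ} = 2n`: `2 · n · (2n − n) = 2n²` — the
dimension of each component of `Ω_P` by LEMMA 4.0.1 («an embedding of `Ω_P` as a non-empty subset, open in the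
classical topology, of the Grassmannian `Gr(n, W_{1,ℂ})`»).
[cite: Markman2025SecantWeil, Lemma 4.0.1, p. 25 L46–47; Lemma 4.0.2 (proof), p. 26 L68–69] -/
theorem grassmannian_real_dim (n : ℕ) : 2 * (n * (2 * n - n)) = 2 * n ^ 2 := by
  rw [show 2 * n - n = n by omega]
  ring

/-- «Thus the real dimension of the adjoint orbit is `2n²`. This is the dimension of each component of `Ω_P`, by
Lemma 4.0.1.» — the two counts agree. [cite: Markman2025SecantWeil, Lemma 4.0.2 (proof), p. 26 L66–69] -/
theorem orbit_dim_eq_component_dim (n : ℕ) :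
    (4 * n ^ 2 - 1) - (2 * n ^ 2 - 1) = 2 * (n * (2 * n - n)) := by
  rw [orbit_dim, grassmannian_real_dim]

/-- The complex dimension of `Gr(n, W_{1,ℂ})`, hence of every component of `Ω_P`: `n · (2n − n) = n²`.
[cite: Markman2025SecantWeil, Lemma 4.0.1, p. 25 L46–47] -/
theorem grassmannian_complex_dim (n : ℕ) : n * (2 * n - n) = n ^ 2 := by
  rw [show 2 * n - n = n by omega]
  ring

/-- The case `n = 3` of the paper's main theorems: the adjoint orbit / `Ω_P` has real dimension
`(4·9 − 1) − (2·9 − 1) = 35 − 17 = 18`, complex dimension `3 · (6 − 3) = 9` — the «9-dimensional moduli space of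
polarized abelian sixfolds of Weil type» of THEOREM 1.4.1 (5).
[cite: Markman2025SecantWeil, Lemma 4.0.2 (proof), p. 26 L66–69; Theorem 1.4.1 (5), p. 7 L53–55] -/
theorem component_dim_three :
    (4 * 3 ^ 2 - 1) - (2 * 3 ^ 2 - 1) = 18 ∧ 3 * (2 * 3 - 3) = 9 ∧ 18 = 2 * 9 := by
  decide

/-- «set `V_U^{1,0} := U ⊕ [U^⊥ ∩ W_{2,ℂ}]`. Then `V_U^{1,0}` is an isotropic `2n`-dimensional subspace of `V_ℂ`»:
`dim U = n`, `dim (U^⊥ ∩ W_{2,ℂ}) = 2n − n` (the pairing puts `W_{1,ℂ}` and `W_{2,ℂ}`, both `2n`-dimensional, in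
perfect duality — printed input), `n + (2n − n) = 2n`. [cite: Markman2025SecantWeil, Lemma 4.0.1 (proof), p. 26 L4–12] -/
theorem isotropic_dim (n : ℕ) : n + (2 * n - n) = 2 * n := by
  omega

/-- «the `−√d`-eigenspace of `I ∘ f` is `U ⊕ Ū` and is `2n`-dimensional. Hence, `ν(I) = 2n`.»
[cite: Markman2025SecantWeil, Lemma 4.0.1 (proof), p. 26 L28–31] -/
theorem nu_eq (n : ℕ) : n + n = 2 * n := by
  omega

/-- The same sentence as linear algebra: two DISJOINT `n`-dimensional subspaces (`U` and `Ū`, transversal since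
`V_U^{1,0} ∩ V_U^{0,1} = 0`) span a `2n`-dimensional one.
[cite: Markman2025SecantWeil, Lemma 4.0.1 (proof), p. 26 L28–31] -/
theorem finrank_sup_of_disjoint {K V : Type*} [DivisionRing K] [AddCommGroup V] [Module K V]
    [FiniteDimensional K V] (U U' : Submodule K V) (n : ℕ) (hU : Module.finrank K U = n)
    (hU' : Module.finrank K U' = n) (h : Disjoint U U') : Module.finrank K ↥(U ⊔ U') = 2 * n := by
  have key := Submodule.finrank_sup_add_finrank_inf_eq U U'
  rw [h.eq_bot, finrank_bot, hU, hU'] at key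
  omega

/-! ### §B. The rotation circle `I_θ = cos(θ)·1 + sin(θ)·I` (Lemma 4.0.3 (2); the subgroup `S_I`, p. 26 L74) -/

section Rotation

open Real

variable {A : Type*} [Ring A] [Algebra ℝ A]

/-- «Consider the subgroup `𝒮_I := {cos(θ) id_{V_ℝ} + sin(θ) I : θ ∈ ℝ}`»: for `I² = −1` the rotations multiply by
adding angles, `I_θ I_φ = I_{θ+φ}` (so `S_I` is closed under products).
[cite: Markman2025SecantWeil, §4 p. 26 L74–75; Lemma 4.0.3 (proof), p. 27 L8] -/
theorem rot_mul_rot (I : A) (hI : I * I = -1) (θ φ : ℝ) :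
    (cos θ • (1 : A) + sin θ • I) * (cos φ • (1 : A) + sin φ • I)
      = cos (θ + φ) • (1 : A) + sin (θ + φ) • I := by
  simp only [mul_add, add_mul, smul_mul_smul_comm, one_mul, mul_one, hI, smul_neg, cos_add, sin_add, sub_eq_add_neg,
    add_smul, neg_smul, mul_comm (sin θ) (cos φ)]
  abel

/-- `I_0 = 1` (the unit of `S_I`). [cite: Markman2025SecantWeil, §4 p. 26 L74–75] -/
theorem rot_zero (I : A) : cos 0 • (1 : A) + sin 0 • I = 1 := by
  simp

/-- «We have seen that `I` is anti-self dual with respect to `(•, •)_V`. Hence, `I_θ† = cos(θ) id_V − sin(θ) I`»: for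
ANY `ℝ`-linear adjunction `†` with `1† = 1` and `I† = −I`.
[cite: Markman2025SecantWeil, Lemma 4.0.3 (proof), p. 27 L12–13] -/
theorem dagger_rot (dag : A →ₗ[ℝ] A) (I : A) (h1 : dag 1 = 1) (hI : dag I = -I) (θ : ℝ) :
    dag (cos θ • (1 : A) + sin θ • I) = cos θ • (1 : A) - sin θ • I := by
  simp [h1, hI, sub_eq_add_neg]

/-- «and `I_θ† I_θ = id_V` and so `I_θ` belongs to `SO(V_ℝ)`»: `(cos θ·1 − sin θ·I)(cos θ·1 + sin θ·I) = 1` for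
`I² = −1` (it is `I_{−θ} I_θ = I_0`). [cite: Markman2025SecantWeil, Lemma 4.0.3 (proof), p. 27 L13–17] -/
theorem rotDagger_mul_rot (I : A) (hI : I * I = -1) (θ : ℝ) :
    (cos θ • (1 : A) - sin θ • I) * (cos θ • (1 : A) + sin θ • I) = 1 := by
  have h := rot_mul_rot I hI (-θ) θ
  simp only [cos_neg, sin_neg, neg_smul, neg_add_cancel, cos_zero, one_smul, sin_zero, zero_smul, add_zero] at h
  simpa [sub_eq_add_neg] using h

/-- The same on the other side: `I_θ I_θ† = 1`, so `I_θ` is invertible with inverse `I_θ†`.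
[cite: Markman2025SecantWeil, Lemma 4.0.3 (proof), p. 27 L13–17] -/
theorem rot_mul_rotDagger (I : A) (hI : I * I = -1) (θ : ℝ) :
    (cos θ • (1 : A) + sin θ • I) * (cos θ • (1 : A) - sin θ • I) = 1 := by
  have h := rot_mul_rot I hI θ (-θ)
  simp only [cos_neg, sin_neg, neg_smul, add_neg_cancel, cos_zero, one_smul, sin_zero, zero_smul, add_zero] at h
  simpa [sub_eq_add_neg] using h

/-- «Clearly, `I_θ` commutes with `f`, as `I` does.» [cite: Markman2025SecantWeil, Lemma 4.0.3 (proof), p. 27 L18] -/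
theorem comm_rot (I f : A) (h : f * I = I * f) (θ : ℝ) :
    f * (cos θ • (1 : A) + sin θ • I) = (cos θ • (1 : A) + sin θ • I) * f := by
  simp only [mul_add, add_mul, mul_smul_comm, smul_mul_assoc, mul_one, one_mul, h]

end Rotation

section Eigen

open Real

/-- «Now `I_θ` acts on `W_i^{1,0}` by scalar multiplication by `cos(θ) + √−1 sin(θ)`»: on a vector with `I v = √−1·v`.
[cite: Markman2025SecantWeil, Lemma 4.0.3 (proof), p. 27 L18–20] -/
theorem rot_apply_of_eigen_I {W : Type*} [AddCommGroup W] [Module ℂ W] (J : W →ₗ[ℂ] W) (v : W)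
    (hv : J v = Complex.I • v) (θ : ℝ) :
    (cos θ : ℂ) • v + (sin θ : ℂ) • J v = ((cos θ : ℂ) + (sin θ : ℂ) * Complex.I) • v := by
  rw [hv, add_smul, mul_smul]

/-- «and on `W_i^{0,1}` by `cos(θ) − √−1 sin(θ)`»: on a vector with `I v = −√−1·v`.
[cite: Markman2025SecantWeil, Lemma 4.0.3 (proof), p. 27 L20–21] -/
theorem rot_apply_of_eigen_negI {W : Type*} [AddCommGroup W] [Module ℂ W] (J : W →ₗ[ℂ] W) (v : W)
    (hv : J v = -(Complex.I • v)) (θ : ℝ) :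
    (cos θ : ℂ) • v + (sin θ : ℂ) • J v = ((cos θ : ℂ) - (sin θ : ℂ) * Complex.I) • v := by
  rw [hv, smul_neg, ← sub_eq_add_neg, sub_smul, mul_smul]

/-- The scalar `cos(θ) + √−1 sin(θ)` is `e^{√−1 θ}` (so `S_I` acts on `W_i^{1,0}` through `U(1)`).
[cite: Markman2025SecantWeil, Lemma 4.0.3 (proof), p. 27 L18–20] -/
theorem rot_scalar_eq_exp (θ : ℝ) : (cos θ : ℂ) + (sin θ : ℂ) * Complex.I = Complex.exp (θ * Complex.I) := by
  rw [Complex.exp_mul_I, ← Complex.ofReal_cos, ← Complex.ofReal_sin]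

/-- «and so the determinant of its restriction to `W_i` is `1`»: `W_i = W_i^{1,0} ⊕ W_i^{0,1}` with both summands
`n`-dimensional (p. 14 L62–65), so the determinant is `(cos θ + √−1 sin θ)^n (cos θ − √−1 sin θ)^n = 1`.
[cite: Markman2025SecantWeil, Lemma 4.0.3 (proof), p. 27 L21–22] -/
theorem det_rot_restrict (n : ℕ) (θ : ℝ) :
    ((cos θ : ℂ) + (sin θ : ℂ) * Complex.I) ^ n * ((cos θ : ℂ) - (sin θ : ℂ) * Complex.I) ^ n = 1 := by
  rw [← mul_pow]
  have h : ((cos θ : ℂ) + (sin θ : ℂ) * Complex.I) * ((cos θ : ℂ) - (sin θ : ℂ) * Complex.I) = 1 := by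
    have hcs : (cos θ : ℂ) ^ 2 + (sin θ : ℂ) ^ 2 = 1 := by exact_mod_cast cos_sq_add_sin_sq θ
    linear_combination (norm := ring_nf) hcs
    rw [Complex.I_sq]; ring
  rw [h, one_pow]

end Eigen

end Literature.AlgebraicGeometry.Markman2025.PeriodDomain
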